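import Summits.ResolutionOfSingularities.ResolutionOfSingularities.Theorems.PurelyInseparableDim4InScopeWinCertFast
import HarnessLib
import HarnessLib.Audit.Tags

/-!
# Purely inseparable fourfolds — IN-SCOPE WIN CERTIFICATES, FAST CHECKER 2 (normalised children)
# [OURS · counted 0 · a certificate format for OUR frame v4, not about resolution]

Census cell «res-dim4-pi» (D-0157 DOOR 2), width seat `res-dim4-p-14` (generation 3).  Sequel of
`PurelyInseparableDim4InScopeWinCertFast` (`equiHB`, `iwinCertHB`, `iwinCertHBL`).

WHY.  After the Hasse–Taylor test removed the expansion at NON-equimultiple replies, the remaining kernel cost sits at the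
EQUIMULTIPLE replies: the child `stepD q S j b s` carries the UNCOMBINED term list of the translate (a few hundred entries for
dense states of degree 10–18), on which the zero test `equivB · []` and every candidate comparison in `ichildIn` are quadratic /
linear.  Here the child is NORMALISED ONCE (`stepDn`: res-dim4-p-13's `ScopeBlind.normL` = collect like terms, prune zeros) before
the zero test and the look-up; the presented STATE is the same (`stepDn_toState`), so the row check reduces to the landed one.

WHAT.  `ireplyNOK` / `irowNOK` / `iwinCertNB` / `iwinCertNBL` = the fast checker with `stepDn` for `stepD`; reductions
`ireplyOK_of_ireplyNOK`, `irowOK_of_irowNOK`, `iwinCertB_of_iwinCertNB`, `iwinCertBL_of_iwinCertNBL`; soundness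
`inScopeStateWins_of_iwinCertNB` / `inScopeStateWins_of_iwinCertNBL` (literally the landed conclusions); model `iwinCertNB_scopeLossCert`.

Riders as before: `K`-rational replies over the finite field `K` of the certificate only (NOT ∀K); a statement about OUR frame-v4
game; nothing here proves resolution of singularities in dimension ≥ 4 / characteristic `p`; F4-C(2,2) neither proved nor refuted.
[OURS · counted 0 · AI kernel work, weaker than expert review.]
bears_on: LADDER-RESOLUTION:D157-DOOR2 (res-dim4-pi · F4-C instrument · certificate format). Supports
stmt-ResolutionOfSingularities-16155 (helper).
-/

set_option linter.dupNamespace false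

noncomputable section

namespace Summit.ResolutionOfSingularities.ResolutionOfSingularities.Theorems.PIDim4

namespace InScopeWinCert

open StepKit WinCertSound ScopeBlind
open Literature.AlgebraicGeometry.Resolution
open Literature.AlgebraicGeometry.Resolution.CentreBlowup

variable {K : Type} [Field K] [DecidableEq K]

/-! ## 1. The normalised child -/

/-- The step on presented states with the term list NORMALISED (like terms collected, zeros pruned). [folklore] -/
def stepDn (q : ℕ) (S : Finset (Fin 4)) (j : Fin 4) (b : Fin 4 → K) (s : SData 4 K) : SData 4 K :=
  ⟨normL (stepD q S j b s).L, (stepD q S j b s).r, (stepD q S j b s).exc⟩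

/-- The normalised child presents the same state. [folklore] -/
theorem stepDn_toState (q : ℕ) (S : Finset (Fin 4)) (j : Fin 4) (b : Fin 4 → K) (s : SData 4 K) :
    (stepDn q S j b s).toState = (stepD q S j b s).toState := by
  simp only [SData.toState, stepDn, evalT_normL]

/-- B's reply `(j, b)` is harmless (fast form, normalised child). [folklore] -/
def ireplyNOK (q : ℕ) (rest : ICert K) (s : SData 4 K) (S : Finset (Fin 4)) (j : Fin 4) (b : Fin 4 → K) : Bool :=
  !(equiHB q S j b s) || StepKit.equivB (stepDn q S j b s).L [] || ichildIn rest (stepDn q S j b s)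

/-- A reply harmless in the normalised fast form is harmless. [folklore] -/
theorem ireplyOK_of_ireplyNOK [Fintype K] {q : ℕ} {rest : ICert K} {s : SData 4 K} {S : Finset (Fin 4)} {j : Fin 4}
    {b : Fin 4 → K} (h : ireplyNOK q rest s S j b = true) : ireplyOK q rest s S j b = true := by
  unfold ireplyNOK at h
  unfold ireplyOK
  cases hH : equiHB q S j b s with
  | false => rw [equiB_eq_false_of_equiHB hH]; simp
  | true =>
    rw [hH] at h
    simp only [Bool.not_true, Bool.false_or, Bool.or_eq_true] at h
    rw [Bool.or_eq_true, Bool.or_eq_true]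
    rcases h with hz | hc
    · refine Or.inl (Or.inr ?_)
      rw [← evalT_eq_zero_iff] at hz ⊢
      rwa [stepDn, evalT_normL] at hz
    · refine Or.inr ?_
      obtain ⟨r, hr, hrc⟩ := exists_of_ichildIn hc
      rw [stepDn_toState] at hrc
      exact List.any_eq_true.mpr ⟨r, hr, (toState_eq_iff _ _).mp hrc⟩

variable [Fintype K]

/-! ## 2. The checkers -/

/-- The row check (normalised fast form). [folklore] -/
def irowNOK (q : ℕ) (rest : ICert K) (row : IRow K) : Bool :=
  blindOK q row || !(permB q Finset.univ row.1.L) ||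
    (permB q row.2.1 row.1.L &&
      decide (∀ j ∈ row.2.1, ∀ b : Fin 4 → K, b j = 0 → ireplyNOK q rest row.1 row.2.1 j b = true))

/-- **Fast in-scope checker 2** (children LATER in the list). [folklore] -/
def iwinCertNB (q : ℕ) : ICert K → Bool
  | [] => true
  | row :: rest => irowNOK q rest row && iwinCertNB q rest

/-- **Fast checker 2 with external leaves.** [folklore] -/
def iwinCertNBL (q : ℕ) (L : List (SData 4 K)) : ICert K → Bool
  | [] => true
  | row :: rest => irowNOK q (rest ++ leafRows L) row && iwinCertNBL q L rest

/-! ## 3. Reduction to the landed checkers, soundness -/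

/-- A fast-2-OK row is OK. [folklore] -/
theorem irowOK_of_irowNOK {q : ℕ} {rest : ICert K} {row : IRow K} (h : irowNOK q rest row = true) :
    irowOK q rest row = true := by
  unfold irowNOK at h
  unfold irowOK
  simp only [Bool.or_eq_true, Bool.and_eq_true, Bool.not_eq_true', decide_eq_true_eq] at h ⊢
  rcases h with (hb | ht) | ⟨hp, hr⟩
  · exact Or.inl (Or.inl hb)
  · exact Or.inl (Or.inr ht)
  · exact Or.inr ⟨hp, fun j hj b hb => ireplyOK_of_ireplyNOK (hr j hj b hb)⟩

/-- **Reduction** (closed form). [folklore] -/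
theorem iwinCertB_of_iwinCertNB {q : ℕ} : ∀ {T : ICert K}, iwinCertNB q T = true → iwinCertB q T = true
  | [], _ => rfl
  | row :: rest, h => by
    simp only [iwinCertNB, Bool.and_eq_true] at h
    simp only [iwinCertB, Bool.and_eq_true]
    exact ⟨irowOK_of_irowNOK h.1, iwinCertB_of_iwinCertNB h.2⟩

/-- **Reduction** (external-leaves form). [folklore] -/
theorem iwinCertBL_of_iwinCertNBL {q : ℕ} {L : List (SData 4 K)} :
    ∀ {T : ICert K}, iwinCertNBL q L T = true → iwinCertBL q L T = true
  | [], _ => rfl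
  | row :: rest, h => by
    simp only [iwinCertNBL, Bool.and_eq_true] at h
    simp only [iwinCertBL, Bool.and_eq_true]
    exact ⟨irowOK_of_irowNOK h.1, iwinCertBL_of_iwinCertNBL h.2⟩

/-- **SOUNDNESS OF FAST CHECKER 2.** [folklore] -/
theorem inScopeStateWins_of_iwinCertNB {q : ℕ} {T : ICert K} (h : iwinCertNB q T = true) :
    ∀ row ∈ T, InScopeStateWins q row.1.toState :=
  inScopeStateWins_of_iwinCertB (iwinCertB_of_iwinCertNB h)

/-- **SOUNDNESS OF FAST CHECKER 2 WITH EXTERNAL LEAVES.** [folklore] -/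
theorem inScopeStateWins_of_iwinCertNBL {q : ℕ} {L : List (SData 4 K)} (hL : ∀ s ∈ L, InScopeStateWins q s.toState)
    {T : ICert K} (h : iwinCertNBL q L T = true) : ∀ row ∈ T, InScopeStateWins q row.1.toState :=
  inScopeStateWins_of_iwinCertBL hL (iwinCertBL_of_iwinCertNBL h)

/-! ## 4. Model -/

/-- The PR-12u model certificate `scopeLossCert` (over `𝔽₂`) passes fast checker 2. [OURS · ‖ K] [folklore] -/
theorem iwinCertNB_scopeLossCert : iwinCertNB 2 scopeLossCert = true := by
  decide +kernel

end InScopeWinCert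

end Summit.ResolutionOfSingularities.ResolutionOfSingularities.Theorems.PIDim4

end
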